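import Mathlib
import Literature.Analysis.FluidPDE.FluidComputerGadget
import HarnessLib

/-!
# Robust fluid-computer gadget libraries: robustness radius in a STATED norm (relative energy norm), stable blow-up, noise-tolerant cascades

HONEST FRAMING: low prior, high value-of-information experiment on Tao's machine paradigm;
NOT a claim that NS blows up.

(Cell `pub-fluidc`, blueprint seat bp2, gen 3. Companion prose: `SPEC-SHEET.md` v0.3 §2 (C′) and
`ASSEMBLY.md` §2c recommendation R1 of seat bp3.)

## Why this file exists

`FluidComputerGadget.lean` types Tao's machine paradigm [cite: Tao2016AveragedNS, §1.3] for TRUE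
Navier–Stokes as an interface `GadgetLibrary ν σ` and proves the soft assembly
`GadgetLibrary.no_global_regular_solution`. Seat bp3's kernel-checked CALIBRATION (cell packet
`ASSEMBLY.md` §2c) observed that, AS TYPED, that interface carries no machine content: its noise
functional `noise : ℕ → Vel → ℝ` is free, so the "robustness radius" `σ.radius` is a radius for an
unspecified functional and a SINGLE clocked blow-up orbit (noise `0` on the orbit, `radius + 1` off
it) is an admissible library. Recommendation R1 there: tie the input classes to a STATED NORM.

This file does exactly that, with the smallest edit that has teeth. A `RobustGadgetLibrary ν σ`
is a `GadgetLibrary ν σ` together with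
* a robustness radius `rho > 0` in the RELATIVE ENERGY NORM: perturbations `w` of a state `v` with
  `∫ ‖w - v‖² ≤ rho² · levelEnergy n v` (squared `L²` distance at most `rho²` times the level energy —
  "in rescaled units, uniformly in the level");
* a noise slack `gap > 0` and an energy-retention factor `theta ∈ (0, 1]`;
* the ROBUSTNESS AXIOM `robust`: such a perturbation raises the level-`n` noise by at most `gap` and
  keeps at least the fraction `theta` of the level-`n` energy (for band energies `E_B(w) = ½‖P_B w‖²`,
  `√(2 E_B)` is `1`-Lipschitz in `L²`, so `theta = (1 - rho/√2)²` is the model value);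
* the seed sits inside its class with margin `gap` (`seed_margin`).
Consequently every input class contains, around each state of noise `≤ radius - gap`, a full ball of
the stated norm — the input classes are `L²`-OPEN in rescaled units — and the single-orbit library of
the calibration is excluded (an `L²`-small, off-orbit modification of an orbit point would have to
jump the noise by `radius + 1 > gap`).

## What is proved

* `RobustGadgetLibrary.reseed` / `RobustGadgetLibrary.stable_blowup`: every Clay-admissible datum
  within relative energy distance `rho` of the seed (`∫ ‖u₀ - seed‖² ≤ rho² E0`) is itself the seed of
  a gadget library with the same specs, hence (in-tree assembly) has NO global smooth bounded-energy
  solution: blow-up for an `L²`-OPEN (relative to the seed energy) set of smooth data — STABLE blow-up,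
  the typed form of Tao's noise-tolerance requirement (§1.3) and strictly more than `¬` Clay (A).
  Needs only `σ.Closure` and the threshold `s⁻¹ < eta`, exactly as the parent theorem.
* `RobustGadgetLibrary.KickedRun`: a NOISE-INJECTED run of the machine — a sequence of Clay-class
  solutions, stage `n` started from an adversarial relative-`L²` kick (size `≤ rho`) of the state
  stage `n - 1` reached after its transfer time `T (n-1)`; `KickedRun.invariant`: under STRICT closure
  of the noise budget with slack `gap` (`GadgetSpec.StrictClosure`: `amp·radius + leak + dStar + eta·gap
  ≤ eta·radius`) every kicked stage still enters its input class and carries level energy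
  `≥ E0 · theta^(n+1) · eta^n`; `KickedRun.speed_unbounded`: if `s⁻¹ < theta · eta` the kicked cascade
  produces unbounded speeds in the fixed ball `B(0, R)` — the computation tolerates noise injected
  between EVERY pair of gates (von Neumann-style fault tolerance, [cite: Tao2016AveragedNS, §1.3]),
  which is the machine content a single blow-up orbit does not have. (This second theorem is not a
  contradiction with regularity by itself — each stage is a global smooth solution by assumption; it is
  the CONTENT statement. The Clay contradiction for the open set of seeds is `stable_blowup`.)

## Deliberately not here

No instance (nothing asserts a robust library exists; the authors do not believe one is likely);
no change to `GadgetSpec` (its fields are the frozen keys of `SPEC-SHEET.json`; `rho`, `gap`, `theta`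
are the v0.3 keys `rho`, `gap`, `theta` of the robust extension and live in the library); the
summit-side one-liner (`¬ NavierStokesRegularity` for every datum in the ball) is in
`Summits/NavierStokesRegularity/NavierStokesRegularity/Theorems/`. Consistency remark recorded, not
formalised: `robust` and the parent's concentration `floor` together force `rho²` to be smaller than
the fraction of level energy carried by the concentration region (an `L²`-kick of relative size `rho`
must not be able to delete the concentrated part) — a design constraint on candidates, measured by the
cell's perturbation-pair protocol (SPEC-SHEET v0.3 §6 R8).
-/

noncomputable section

open scoped ContDiff ENNReal Topology
open Filter Set Metric MeasureTheory

namespace Literature.Analysis.FluidPDE.FluidComputer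

/-- The STATED NORM of the robust interface: squared energy-norm (`L²(ℝ³)`) distance of two velocity
fields, `∫⁻ ‖v x - w x‖ₑ²`, as a lower Lebesgue integral (always defined, possibly `∞`; same
convention as the Clay bounded-energy condition `HasBoundedEnergy`). [folklore] -/
def l2DistSq (v w : Vel) : ℝ≥0∞ := ∫⁻ x, ‖v x - w x‖ₑ ^ 2

/-- A field is at squared energy distance `0` from itself. [folklore] -/
@[simp] lemma l2DistSq_self (v : Vel) : l2DistSq v v = 0 := by
  simp [l2DistSq]

/-- The squared energy distance is symmetric. [folklore] -/
lemma l2DistSq_comm (v w : Vel) : l2DistSq v w = l2DistSq w v := by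
  unfold l2DistSq
  congr 1 with x
  rw [← edist_eq_enorm_sub, edist_comm, edist_eq_enorm_sub]

namespace GadgetSpec

variable (σ : GadgetSpec)

/-- STRICT CLOSURE of the affine noise recursion with slack `gap`:
`amp * radius + leak + dStar + eta * gap ≤ eta * radius`, i.e. `eta ≥ amp + (leak + dStar) / radius
+ eta * gap / radius` — after a step from anywhere in the input class the delivered noise is at most
`radius - gap`, leaving room `gap` for noise injected between gates (SPEC-SHEET v0.3 §2 (C′)).
[folklore] -/
structure StrictClosure (gap : ℝ) : Prop where
  /-- the affine noise map sends `[0, radius]` into `[0, radius - gap]` -/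
  le : σ.amp * σ.radius + σ.leak + σ.dStar + σ.eta * gap ≤ σ.eta * σ.radius

variable {σ}

/-- Strict closure with nonnegative slack implies closure. [folklore] -/
lemma StrictClosure.closure {gap : ℝ} (h : σ.StrictClosure gap) (hσ : σ.Valid) (hgap : 0 ≤ gap) :
    σ.Closure :=
  ⟨by nlinarith [h.le, hσ.eta_pos]⟩

/-- Threshold arithmetic: `1 < s`, `0 < e`, `s⁻¹ < e` give `1 < s ^ 3 * e` (used with the effective
efficiency `e = theta * eta` of a kicked cascade). [folklore] -/
lemma one_lt_cube_mul_of_inv_lt {s e : ℝ} (hs : 1 < s) (he : 0 < e) (h : s⁻¹ < e) :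
    1 < s ^ 3 * e := by
  have hs0 : 0 < s := zero_lt_one.trans hs
  have h1 : 1 < s * e := by
    have := mul_lt_mul_of_pos_left h hs0
    rwa [mul_inv_cancel₀ hs0.ne'] at this
  calc (1 : ℝ) < s * e := h1
    _ ≤ s ^ 3 * e := mul_le_mul_of_nonneg_right (le_self_pow₀ hs.le (by norm_num)) he.le

end GadgetSpec

/-- A ROBUST GADGET LIBRARY for true Navier–Stokes with viscosity `ν` and specs `σ`: a
`GadgetLibrary ν σ` whose input classes are OPEN IN A STATED NORM, uniformly in the level in rescaled
units. Extra data: the robustness radius `rho > 0` in the RELATIVE ENERGY NORM (squared `L²` distance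
`≤ rho² · levelEnergy n v`), the noise slack `gap > 0`, the energy-retention factor `theta ∈ (0,1]`;
axioms: `robust` (a relative-`L²` perturbation of size `≤ rho` of any state raises the level-`n` noise
by at most `gap` and keeps at least the fraction `theta` of the level-`n` energy) and `seed_margin`
(the seed is inside its class with margin `gap`). The typed form of recommendation R1 of the cell's
`ASSEMBLY.md` §2c and of the noise-tolerance requirement of [cite: Tao2016AveragedNS, §1.3]; for the
averaged equation the analogous statement is Prop 6.4 there (errors do not accumulate along the
chain). Nothing asserts such a library exists. -/
structure RobustGadgetLibrary (ν : ℝ) (σ : GadgetSpec) extends GadgetLibrary ν σ where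
  /-- robustness radius in the relative energy norm -/
  rho : ℝ
  /-- positivity of the robustness radius -/
  rho_pos : 0 < rho
  /-- noise slack: room left in the input class for injected noise -/
  gap : ℝ
  /-- positivity of the slack -/
  gap_pos : 0 < gap
  /-- energy-retention factor under an admissible perturbation -/
  theta : ℝ
  /-- positivity of the retention factor -/
  theta_pos : 0 < theta
  /-- a perturbation never certifies MORE energy than was there -/
  theta_le_one : theta ≤ 1
  /-- the seed sits inside the level-0 input class with margin `gap` -/
  seed_margin : noise 0 seed + gap ≤ σ.radius
  /-- THE ROBUSTNESS AXIOM (input classes `L²`-open in rescaled units, uniformly in `n`): a field `w`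
  within squared energy distance `rho² · levelEnergy n v` of `v` has level-`n` noise at most
  `noise n v + gap` and level-`n` energy at least `theta · levelEnergy n v` -/
  robust : ∀ (n : ℕ) (v w : Vel), l2DistSq w v ≤ ENNReal.ofReal (rho ^ 2 * levelEnergy n v) →
    noise n w ≤ noise n v + gap ∧ theta * levelEnergy n v ≤ levelEnergy n w

namespace RobustGadgetLibrary

variable {ν : ℝ} {σ : GadgetSpec} (lib : RobustGadgetLibrary ν σ)

/-- The relative-`L²` ball of radius `rho` around the seed, measured with the certified seed energy
`E0`, lies inside the ball measured with the seed's actual level-0 energy. [folklore] -/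
lemma ball_seed_mono {u₀ : Vel} (h : l2DistSq u₀ lib.seed ≤ ENNReal.ofReal (lib.rho ^ 2 * lib.E0)) :
    l2DistSq u₀ lib.seed ≤ ENNReal.ofReal (lib.rho ^ 2 * lib.levelEnergy 0 lib.seed) :=
  h.trans (ENNReal.ofReal_le_ofReal (mul_le_mul_of_nonneg_left lib.seed_energy (sq_nonneg _)))

/-- A datum within relative energy distance `rho` of the seed is in the level-0 input class.
[folklore] -/
lemma noise_le_of_near_seed {u₀ : Vel}
    (h : l2DistSq u₀ lib.seed ≤ ENNReal.ofReal (lib.rho ^ 2 * lib.E0)) :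
    lib.noise 0 u₀ ≤ σ.radius :=
  ((lib.robust 0 lib.seed u₀ (lib.ball_seed_mono h)).1).trans lib.seed_margin

/-- A datum within relative energy distance `rho` of the seed carries level-0 energy at least
`theta * E0`. [folklore] -/
lemma energy_ge_of_near_seed {u₀ : Vel}
    (h : l2DistSq u₀ lib.seed ≤ ENNReal.ofReal (lib.rho ^ 2 * lib.E0)) :
    lib.theta * lib.E0 ≤ lib.levelEnergy 0 u₀ :=
  (mul_le_mul_of_nonneg_left lib.seed_energy lib.theta_pos.le).trans
    (lib.robust 0 lib.seed u₀ (lib.ball_seed_mono h)).2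

/-- RESEEDING: every Clay-admissible datum (smooth, divergence free, rapidly decaying) within
relative energy distance `rho` of the seed is itself the seed of a gadget library with the SAME specs
(certified seed energy `theta * E0`). [folklore] -/
def reseed (u₀ : Vel) (h1 : ContDiff ℝ ∞ u₀) (h2 : NSWave0.IsDivFree u₀)
    (h3 : HasRapidSpatialDecay u₀)
    (h : l2DistSq u₀ lib.seed ≤ ENNReal.ofReal (lib.rho ^ 2 * lib.E0)) : GadgetLibrary ν σ :=
  { lib.toGadgetLibrary with
    seed := u₀
    seed_smooth := h1
    seed_divFree := h2
    seed_decay := h3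
    seed_noise := lib.noise_le_of_near_seed h
    E0 := lib.theta * lib.E0
    E0_pos := mul_pos lib.theta_pos lib.E0_pos
    seed_energy := lib.energy_ge_of_near_seed h }

/-- The reseeded library has the prescribed seed. [folklore] -/
@[simp] lemma reseed_seed (u₀ : Vel) (h1 : ContDiff ℝ ∞ u₀) (h2 : NSWave0.IsDivFree u₀)
    (h3 : HasRapidSpatialDecay u₀)
    (h : l2DistSq u₀ lib.seed ≤ ENNReal.ofReal (lib.rho ^ 2 * lib.E0)) :
    (lib.reseed u₀ h1 h2 h3 h).seed = u₀ := rfl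

/-- **STABLE BLOW-UP (blow-up for an `L²`-open set of smooth data).** For a robust gadget library
with valid, closing specs above the efficiency threshold `s⁻¹ < eta`, EVERY smooth, divergence-free,
rapidly decaying datum `u₀` with `∫ ‖u₀ - seed‖² ≤ rho² · E0` admits no global smooth bounded-energy
Navier–Stokes solution (viscosity `ν`, zero force). Proof: reseed and apply the in-tree assembly
`GadgetLibrary.no_global_regular_solution`. This is the typed form of the noise tolerance asked for
in [cite: Tao2016AveragedNS, §1.3]; a single blow-up orbit does NOT give it. HONEST FRAMING: an
implication from an interface nobody has instantiated; NOT a claim that NS blows up. -/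
theorem stable_blowup (hσ : σ.Valid) (hclos : σ.Closure) (hvisc : σ.s⁻¹ < σ.eta)
    (u₀ : Vel) (h1 : ContDiff ℝ ∞ u₀) (h2 : NSWave0.IsDivFree u₀) (h3 : HasRapidSpatialDecay u₀)
    (h : l2DistSq u₀ lib.seed ≤ ENNReal.ofReal (lib.rho ^ 2 * lib.E0)) :
    ¬ ∃ (u : ℝ → Vel) (p : ℝ → E3 → ℝ), IsSmoothOnHalfSpace u ∧ IsSmoothOnHalfSpace p ∧
        IsNavierStokesSolution ν 0 u₀ u p ∧ HasBoundedEnergy u :=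
  (lib.reseed u₀ h1 h2 h3 h).no_global_regular_solution hσ hclos hvisc

/-- The seed itself is in the ball, so `stable_blowup` contains the parent theorem. [folklore] -/
lemma seed_mem_ball : l2DistSq lib.seed lib.seed ≤ ENNReal.ofReal (lib.rho ^ 2 * lib.E0) := by
  simp

/-- A NOISE-INJECTED (KICKED) RUN of the machine: stage `n` is a Clay-class Navier–Stokes solution
`u n` (smooth on `[0,∞) × ℝ³`, bounded energy) started, on its own clock, from a datum `w n`, where
`w 0` is a relative-`L²` kick of size `≤ rho` of the seed and `w (n+1)` is a relative-`L²` kick of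
size `≤ rho` (relative to the level-`(n+1)` energy present) of the state `u n (T n)` that stage `n`
reaches after its transfer time. Models an adversary injecting noise between every pair of gates
(fault tolerance in the sense of [cite: Tao2016AveragedNS, §1.3]). [folklore] -/
structure KickedRun where
  /-- entry state of stage `n` (after the kick) -/
  w : ℕ → Vel
  /-- the stage-`n` velocity, on its own clock -/
  u : ℕ → ℝ → Vel
  /-- the stage-`n` pressure -/
  p : ℕ → ℝ → E3 → ℝ
  /-- each stage is smooth on the closed half-space -/
  smooth_u : ∀ n, IsSmoothOnHalfSpace (u n)
  /-- each pressure is smooth on the closed half-space -/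
  smooth_p : ∀ n, IsSmoothOnHalfSpace (p n)
  /-- each stage solves Navier–Stokes from its entry state -/
  sol : ∀ n, IsNavierStokesSolution ν 0 (w n) (u n) (p n)
  /-- each stage has bounded energy -/
  energy : ∀ n, HasBoundedEnergy (u n)
  /-- the first entry state is an admissible kick of the seed -/
  kick_zero : l2DistSq (w 0) lib.seed ≤ ENNReal.ofReal (lib.rho ^ 2 * lib.E0)
  /-- entry state `n+1` is an admissible kick of the exit state of stage `n` -/
  kick_succ : ∀ n, l2DistSq (w (n + 1)) (u n (lib.T n)) ≤
    ENNReal.ofReal (lib.rho ^ 2 * lib.levelEnergy (n + 1) (u n (lib.T n)))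

variable {lib}

/-- **THE KICKED-CASCADE INVARIANT.** Under valid specs with STRICT closure of slack `gap`, every
stage of a kicked run enters its input class (`noise n (w n) ≤ radius`) and carries level-`n` energy
at least `E0 · theta^(n+1) · eta^n`: injected noise of relative size `rho` between the gates does not
accumulate (induction on the level: step ⇒ noise `≤ radius - gap`, kick ⇒ `+ gap`; energy `× eta`
per step, `× theta` per kick). The averaged-equation analogue is [cite: Tao2016AveragedNS, Prop 6.4].
[folklore] -/
theorem KickedRun.invariant (hσ : σ.Valid) (hclos : σ.StrictClosure lib.gap) (run : lib.KickedRun)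
    (n : ℕ) :
    lib.noise n (run.w n) ≤ σ.radius ∧
      lib.E0 * lib.theta ^ (n + 1) * σ.eta ^ n ≤ lib.levelEnergy n (run.w n) := by
  induction n with
  | zero =>
    refine ⟨lib.noise_le_of_near_seed run.kick_zero, ?_⟩
    calc lib.E0 * lib.theta ^ (0 + 1) * σ.eta ^ 0 = lib.theta * lib.E0 := by ring
      _ ≤ lib.levelEnergy 0 (run.w 0) := lib.energy_ge_of_near_seed run.kick_zero
  | succ n ih =>
    obtain ⟨hx, hEn⟩ := ih
    -- the step, applied to stage `n` from its entry state at its own time `0`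
    have hstep := lib.step (run.w n) (run.u n) (run.p n) (run.smooth_u n) (run.smooth_p n)
      (run.sol n) (run.energy n) n 0 le_rfl (by rw [(run.sol n).initial]; exact hx)
    rw [(run.sol n).initial, zero_add] at hstep
    obtain ⟨hnoise, henergy⟩ := hstep
    -- the kick, absorbed by the robustness axiom at level `n + 1`
    obtain ⟨hkn, hke⟩ := lib.robust (n + 1) (run.u n (lib.T n)) (run.w (n + 1)) (run.kick_succ n)
    refine ⟨?_, ?_⟩
    · -- delivered noise ≤ radius - gap, plus gap
      have h1 : σ.eta * lib.noise (n + 1) (run.u n (lib.T n)) ≤ σ.eta * (σ.radius - lib.gap) :=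
        calc σ.eta * lib.noise (n + 1) (run.u n (lib.T n))
            ≤ σ.amp * lib.noise n (run.w n) + σ.leak + σ.dStar := hnoise
          _ ≤ σ.amp * σ.radius + σ.leak + σ.dStar := by
              have := mul_le_mul_of_nonneg_left hx hσ.amp_nonneg
              linarith
          _ ≤ σ.eta * (σ.radius - lib.gap) := by linarith [hclos.le]
      have h2 : lib.noise (n + 1) (run.u n (lib.T n)) ≤ σ.radius - lib.gap :=
        le_of_mul_le_mul_left h1 hσ.eta_pos
      linarith
    · -- energy: × eta through the step, × theta through the kick
      calc lib.E0 * lib.theta ^ (n + 1 + 1) * σ.eta ^ (n + 1)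
          = lib.theta * (σ.eta * (lib.E0 * lib.theta ^ (n + 1) * σ.eta ^ n)) := by ring
        _ ≤ lib.theta * (σ.eta * lib.levelEnergy n (run.w n)) :=
            mul_le_mul_of_nonneg_left (mul_le_mul_of_nonneg_left hEn hσ.eta_pos.le)
              lib.theta_pos.le
        _ ≤ lib.theta * lib.levelEnergy (n + 1) (run.u n (lib.T n)) :=
            mul_le_mul_of_nonneg_left henergy lib.theta_pos.le
        _ ≤ lib.levelEnergy (n + 1) (run.w (n + 1)) := hke

/-- **NOISE-TOLERANT AMPLIFICATION.** Under valid specs, strict closure and the KICKED efficiency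
threshold `s⁻¹ < theta * eta`, the entry states of a kicked run have unbounded squared speed inside
the fixed ball of radius `R`: for every `M` some stage `n` and point `‖x‖ ≤ R` have
`M < ‖w n x‖²` — the cascade computes through adversarial relative-`L²` noise of size `rho` injected
between every pair of gates, within total machine time `Σ T n ≤ horizon`
(`GadgetLibrary.checkpoint_le_horizon`). This is the machine content (robust, self-amplifying
computation) that a single blow-up orbit does not carry; it is NOT by itself a contradiction with
regularity (every stage is a global smooth solution by assumption). HONEST FRAMING: an implication
from an interface nobody has instantiated; NOT a claim that NS blows up. [folklore] -/
theorem KickedRun.speed_unbounded (hσ : σ.Valid) (hclos : σ.StrictClosure lib.gap)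
    (hvisc : σ.s⁻¹ < lib.theta * σ.eta) (run : lib.KickedRun) (M : ℝ) :
    ∃ (n : ℕ) (x : E3), ‖x‖ ≤ lib.R ∧ M < ‖run.w n x‖ ^ 2 := by
  -- the floor along the kicked cascade: `cFloor * k0³ * E0 * theta * (s³ * theta * eta)ⁿ → ∞`
  have hq : 1 < σ.s ^ 3 * (lib.theta * σ.eta) :=
    GadgetSpec.one_lt_cube_mul_of_inv_lt hσ.one_lt_s (mul_pos lib.theta_pos hσ.eta_pos) hvisc
  have hA : 0 < lib.cFloor * σ.k0 ^ 3 * (lib.E0 * lib.theta) :=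
    mul_pos (mul_pos lib.cFloor_pos (pow_pos hσ.k0_pos 3)) (mul_pos lib.E0_pos lib.theta_pos)
  have htend : Tendsto
      (fun n : ℕ => lib.cFloor * σ.k0 ^ 3 * (lib.E0 * lib.theta) * (σ.s ^ 3 * (lib.theta * σ.eta)) ^ n)
      atTop atTop :=
    (tendsto_pow_atTop_atTop_of_one_lt hq).const_mul_atTop hA
  obtain ⟨n, hn⟩ := (htend.eventually_gt_atTop M).exists
  obtain ⟨hx, hEn⟩ := run.invariant hσ hclos n
  obtain ⟨x, hxR, hfloor⟩ := lib.floor n (run.w n) hx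
  refine ⟨n, x, hxR, ?_⟩
  have hk3 : 0 ≤ lib.cFloor * σ.k n ^ 3 :=
    mul_nonneg lib.cFloor_pos.le (pow_nonneg (GadgetSpec.k_pos hσ n).le 3)
  have heq : lib.cFloor * σ.k0 ^ 3 * (lib.E0 * lib.theta) * (σ.s ^ 3 * (lib.theta * σ.eta)) ^ n =
      lib.cFloor * σ.k n ^ 3 * (lib.E0 * lib.theta ^ (n + 1) * σ.eta ^ n) := by
    unfold GadgetSpec.k; ring
  calc M < lib.cFloor * σ.k0 ^ 3 * (lib.E0 * lib.theta) * (σ.s ^ 3 * (lib.theta * σ.eta)) ^ n := hn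
    _ = lib.cFloor * σ.k n ^ 3 * (lib.E0 * lib.theta ^ (n + 1) * σ.eta ^ n) := heq
    _ ≤ lib.cFloor * σ.k n ^ 3 * lib.levelEnergy n (run.w n) := mul_le_mul_of_nonneg_left hEn hk3
    _ ≤ ‖run.w n x‖ ^ 2 := hfloor

/-- Total machine time of the first `n` stages of a kicked run is the library's `n`-th checkpoint,
hence at most `σ.horizon` (SPEC-SHEET §2 (A)): the noise-tolerant amplification happens in finite
time. [folklore] -/
lemma KickedRun.elapsed_le_horizon (hσ : σ.Valid) (_run : lib.KickedRun) (n : ℕ) :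
    ∑ m ∈ Finset.range n, lib.T m ≤ σ.horizon :=
  lib.checkpoint_le_horizon hσ n

end RobustGadgetLibrary

end Literature.Analysis.FluidPDE.FluidComputer

end
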